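/-
Copyright: cell pub-balaban-gaps (YM BLITZ Y1, track G1), seat g1-p2 GEN 4 (unit `pub-balaban-gaps-g1-p2`).  Row (D4) NODE O,
OBJECT ∕ MECHANISM level: [B9] THEOREM 3.10 AT ONE SCALE in the NODE-O currency, END TO END — domain-localised seed and step
families (`B13DomainKernelWalks`, the shape of `h_□G′_□h_□` and `K(h_□)G′_□h_□` given Cor 3.6-type local inverse data) ⟹ the
glued inverse `S·(1 − R)⁻¹` is a `JointWalkExpansion` with TORUS-UNIFORM constants (`D4WalkGlue`).  HONEST FRAMING: composition of
landed∕staged SHAPE lemmas; nothing of Bałaban's constructed or asserted; (D4) NOT discharged (instance 0∕1); NOT BetaPertH,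
NOT continuum, NOT Clay.
-/
import Literature.MathematicalPhysics.QuantumFieldTheory.Balaban1983to89.B13DomainKernelWalks
import Summits.QuantumFields.BalabanUV.Gaps.D4WalkGlue

/-!
# `Gaps.D4WalkOneScale` — Theorem 3.10 at one scale: domain-local seed ∕ step data ⟹ the glued inverse is a joint walk expansion,
# torus-uniformly (cell pub-balaban-gaps, seat g1-p2 gen 4)

HONEST DEPENDENCY (cell pub-balaban, verbatim): continuum YM on T⁴ ⇐ BetaPertH ∧ nine spine estimates (0/9 proved);
BetaPertH ⇐ (D1) ∧ (D4) ∧ CAP+tail.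

[B9] pp. 409–410, 416: `G′ = (Σ_□ h_□G′_□h_□)·(I − Σ_□ K(h_□)G′_□h_□)⁻¹` ((3.87)–(3.90)) is the random walk expansion (3.107) with
the bounds (3.108), *"The constant O(1) depends on d and L only"*.  `jointWalkExpansion_oneScale`: if the seed family `S` and the
step family `R` are DOMAIN-LOCALISED one-step operator families (`DomainTerms.IsDomainLocal` with letters `(R, λ_S ∕ λ_R, r, m_J,
n_D)`, domains of diameter `≤ r` meeting the σ-region when σ-carrying, operator coefficients analytic on the `R`-ball), the row sum
(2.61) holds at rate `μ` with constant `c_μ` (on every one-scale torus: `c₀(1,μ)^ν`), the rates satisfy `0 ≤ μ`, `3μ ≤ ε₀`,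
`2μ ≤ κ₀`, `κ₀ + μ ≤ ρ₀ − ε₀`, and the Neumann MARGIN `q = (mc_μ)((mc_μ)·1·(1·K̄_R)·c_μ)c_μ < 1` holds, `K̄_R = λ_Re^{κ₁m_J}
e^{2ρ₀r}e^{μr}n_Dc_μ` — with THESE (flat) letters a SMALL-`λ_R` condition at FIXED `(r, ρ₀, μ, n_D)`, a model regime; print's
*"for M sufficiently large"* at `K(h_□) = O(M⁻¹)` is NOT captured here (at `r ≍ M` the factor `e^{2ρ₀r}` grows; g1-plan-1 X24-1,
N21-1, N22-1: the passage-decaying letters of `B13DomainKernelWalksDecay` remove `e^{2ρ₀r}`, an indicator count removes the anchor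
row sum) —, then
`(σ,u) ↦ S(σ,u)·(1 − R(σ,u))⁻¹` is a `JointWalkExpansion` on the `R`-ball at walk rate `ρ₀ − 3μ`, window `ε₀ − 3μ`, torus rate
`κ₀ − 2μ`, constant `(mc_μ)·K̄_S·(1·(1 − q)⁻¹)·c_μ` — EVERY LETTER INDEPENDENT OF THE TORUS; terms ∃-packaged (as `TermWalkData`
consumes them), walk distances dominating `d₁`.  Composition by name: `DomainTerms.jointWalkExpansion_domainLocal` (×2) →
`D4WalkGlue.jointWalkExpansion_glue`.  The R5c letters (`B13DomainKernelWalksDecay`, passage-decaying entries, no `e^{2ρ₀r}`)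
feed the same glue verbatim through `IsDomainLocalD.toFlat` or directly.
WHAT IT IS NOT: Bałaban's `Δ′`, `G′_□`, `h_□`, `K(h_□)` are NOT constructed — the two `IsDomainLocal` data are the Cor 3.6 ∕
(3.89)-type HYPOTHESES in NODE-O currency; the multi-scale structure (𝒟_k, block averaging, covariant operators), k-uniformity
(G-B9-10 ∕ (v)) and `TermDomination` remain; (D4) instance 0∕1; words UNCHANGED.
-/

noncomputable section

namespace Summit.QuantumFields.BalabanUV.Gaps.D4WalkOneScale

open Metric Set Finset
open Literature.MathematicalPhysics.QuantumFieldTheory.Balaban1983to89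
open Literature.MathematicalPhysics.QuantumFieldTheory.Balaban1983to89.B9SectDWalk (Through MajSumLe DomBy)
open Literature.MathematicalPhysics.QuantumFieldTheory.Balaban1983to89.B9Thm34Ext (toB6)
open Literature.MathematicalPhysics.QuantumFieldTheory.Balaban1983to89.B9Thm37GlueTorus (torusGeom tdist1 tdist1_nonneg)
open Literature.MathematicalPhysics.QuantumFieldTheory.Balaban1983to89.TreeLengthTorus (TPt)
open Literature.MathematicalPhysics.QuantumFieldTheory.Balaban1983to89.B5TorusCover (UT)
open Literature.MathematicalPhysics.QuantumFieldTheory.Balaban1983to89.B11SectG (RowSum)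
open Literature.MathematicalPhysics.QuantumFieldTheory.Balaban1983to89.B13JointWalkExpansion (JointWalkExpansion)
open Literature.MathematicalPhysics.QuantumFieldTheory.Balaban1983to89.B13DomainKernelWalks (DomainTerms)
open Summit.QuantumFields.BalabanUV.Gaps.D4WalkGlue (jointWalkExpansion_glue)

variable {ν : ℕ} {Nf : Fin ν → ℕ} [∀ i, NeZero (Nf i)]
variable {d N' : ℕ} {p n : Type} [Fintype n] [DecidableEq n]
variable {E : Type*} [NormedAddCommGroup E] [NormedSpace ℂ E]
variable {c : B13.Consts} {locp : p → UT Nf} {locn : n → UT Nf} {X : Finset (UT Nf)}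

/-- **THEOREM 3.10 AT ONE SCALE, NODE-O CURRENCY**: domain-localised seed family `S` (`p × n`) and step family `R` (`n × n`) with
common letters, one row-sum rate `μ` (constant `c_μ`), rates `0 ≤ μ`, `3μ ≤ ε₀`, `2μ ≤ κ₀`, `κ₀ + μ ≤ ρ₀ − ε₀`, fibre `m` of
`locn`, and the margin `q < 1` ⟹ the glued inverse `S·(1 − R)⁻¹` is a joint walk expansion at `(ρ₀ − 3μ, ε₀ − 3μ, κ₀ − 2μ)` with
constant `(mc_μ)·K̄_S·(1·(1 − q)⁻¹)·c_μ`, all letters torus-free. [cite: Balaban1985BackgroundPropagators, (3.87)–(3.90) p.409, Thm 3.10 (3.107)–(3.108) p.416, p.422; Balaban1984PropagatorsII, (2.61) p.234; Balaban1988RG2Cluster, (1.11) p.5, p.13, p.15] -/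
theorem jointWalkExpansion_oneScale {LS : DomainTerms d N' ν Nf p n E} {LR : DomainTerms d N' ν Nf n n E}
    {R lamS lamR r : ℝ} {mJ nD m : ℕ} {ρ₀ ε₀ κ₀ μ cμ : ℝ}
    (hS : LS.IsDomainLocal c locp locn X R lamS r mJ nD) (hR : LR.IsDomainLocal c locn locn X R lamR r mJ nD)
    (hκ₁ : 0 ≤ c.κ₁) (hlamS : 0 ≤ lamS) (hlamR : 0 ≤ lamR)
    (hμ : 0 ≤ μ) (hμε : 3 * μ ≤ ε₀) (hμκ : 2 * μ ≤ κ₀) (hwin : κ₀ + μ ≤ ρ₀ - ε₀) (hcμ : 0 ≤ cμ)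
    (hrow : RowSum (toB6 (torusGeom Nf 0 0 0) 0 True) μ cμ)
    (hfib : ∀ y : UT Nf, (Finset.univ.filter fun k => locn k = y).card ≤ m)
    (hq : (m * cμ) * ((m * cμ) * 1 *
      (1 * ((lamR * Real.exp (c.κ₁ * mJ) * Real.exp (2 * ρ₀ * r)) * Real.exp (μ * r) * (nD * cμ))) * cμ) * cμ < 1) :
    ∃ (W : Type) (T : W → (TPt d N' → ℂ) → E → Matrix p n ℂ) (SX : Set W) (A : W → ℝ) (D : W → UT Nf → UT Nf → ℝ)
      (ρ' : ℝ), JointWalkExpansion c locp locn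
        (fun σ₀ u => LS.kernel σ₀ u * ((1 : Matrix n n ℂ) + (-1 : ℂ) • LR.kernel σ₀ u)⁻¹) X R (ε₀ - 3 * μ) (κ₀ - 2 * μ)
        ((m * cμ) * ((lamS * Real.exp (c.κ₁ * mJ) * Real.exp (2 * ρ₀ * r)) * Real.exp (μ * r) * (nD * cμ)) *
          (1 * (1 - (m * cμ) * ((m * cμ) * 1 *
            (1 * ((lamR * Real.exp (c.κ₁ * mJ) * Real.exp (2 * ρ₀ * r)) * Real.exp (μ * r) * (nD * cμ))) * cμ) * cμ)⁻¹) * cμ)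
        T SX A D ρ' ∧
      ∀ ω, DomBy (toB6 (torusGeom Nf 0 0 0) 0 True) (D ω) := by
  have hκ₀ : 0 ≤ κ₀ := by linarith
  have hρ₀ : 0 ≤ ρ₀ := by linarith
  -- the two domain-local expansions at (ρ₀, ε₀, κ₀)
  have hSw := DomainTerms.jointWalkExpansion_domainLocal hS hκ₁ hlamS hρ₀ hκ₀ hμ hwin hrow
  have hRw := DomainTerms.jointWalkExpansion_domainLocal hR hκ₁ hlamR hρ₀ hκ₀ hμ hwin hrow
  -- glue: Neumann window (ρ₀ − 2μ, ε₀ − 2μ), ρ_s = ρ₀ − μ, κ_s = κ₀ − μ, κ = κ₀ − 2μ; product window (ρ₀ − 3μ, ε₀ − 3μ, κ₀ − 2μ)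
  exact jointWalkExpansion_glue (ρ := ρ₀ - 2 * μ) (ε := ε₀ - 2 * μ) (ρs := ρ₀ - μ) (κs := κ₀ - μ) (κ := κ₀ - 2 * μ)
    (ρ' := ρ₀ - 3 * μ) (ε' := ε₀ - 3 * μ) (κ' := κ₀ - 2 * μ)
    hSw hRw (fun b => LS.domBy_dist X b) (fun b => LR.domBy_dist X b) hfib hrow hrow hμ hμ hcμ hcμ
    -- step 1 (Neumann): hε hερ hρs hρsR hwR hKR hκs hκsR hκsC hκ hκC hκκs hq
    (by linarith) (by linarith) (by linarith) (by linarith) (by linarith) (by positivity) (by linarith) (by linarith)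
    (by linarith) (by linarith) (by linarith) (by linarith) hq
    -- step 2 (product): hρ' hρ'ρ hρ'S hε' hwS hw1 hKS hκ' hκ'κ hκ'S
    (by linarith) (by linarith) (by linarith) (by linarith) (by linarith) (by linarith) (by positivity) (by linarith) le_rfl
    (by linarith)

end Summit.QuantumFields.BalabanUV.Gaps.D4WalkOneScale

end
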